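import Literature.NumberTheory.Sieve.MaynardSieveS1
import Literature.NumberTheory.Sieve.MaynardSieveWeightsM
import Literature.NumberTheory.Sieve.CoprimeSquarefreeSumsSmooth
import HarnessLib

/-!
# Maynard 2015, Lemma 6.3 (`S₂^{(m)}` half of Prop. 4.1) reduced to Lemma 5.2 and the two evaluations of its proof

Topic `Literature/NumberTheory/Sieve`; continues `MaynardSieve.lean` (the named fact
`Literature.NumberTheory.Sieve.maynard_S2_asymptotic` = Maynard's Lemma 6.3), `MaynardSieveWeightsM.lean` (the variables
`y^{(m)}_r`, `Literature.NumberTheory.Sieve.maynardYm`, and Maynard's `g`, `Literature.NumberTheory.Sieve.maynardG`) and `MaynardSieveS1.lean` (the same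
reduction for `S₁`). J. Maynard, *Small gaps between primes*, Ann. of Math. (2) 181 (2015), 383–413
= arXiv:1311.4600; pages refer to the arXiv text.

The printed proof of Lemma 6.3 (p. 14) has three inputs, vendored here as named facts, and a
combination, PROVED here:

* `Literature.NumberTheory.Sieve.maynard_lemma52` — **Lemma 5.2** (p. 10):
  `S₂^{(m)} = N/(φ(W) log N) · ∑_r (y^{(m)}_r)²/∏ g(rᵢ) + O((y^{(m)}_max)² φ(W)^{k−2} N (log N)^{k−2}/(W^{k−1} D₀)) + O(y_max² N/(log N)^A)`
  (the Selberg-sieve diagonalisation of `S₂^{(m)}`, §5, using the level of distribution `θ` of the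
  primes for the moduli `q < R² W` and the prime number theorem for `X_N`);
* `Literature.NumberTheory.Sieve.maynard_lemma63_ym` — the evaluation of `y^{(m)}` in the proof of Lemma 6.3 (p. 14, the
  display "`y^{(m)}_{r} = (log R) (φ(W)/W) (∏ φ(rᵢ)/rᵢ) F^{(m)}_r + O(F_max φ(W) log R/(W D₀))`",
  obtained from Lemma 5.3 and one application of the partial-summation Lemma 6.1), with
  `F^{(m)}_r = ∫₀¹ F(log r₁/log R, …, t_m, …, log r_k/log R) dt_m` (`maynardFm`);
* `Literature.NumberTheory.Sieve.maynard_lemma63_sum` — the evaluation of the resulting smooth sum (p. 14, from the display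
  "`S₂^{(m)} = (φ(W) N (log R)²/(W² log N)) ∑ …`" to the end of the proof: removal of the conditions
  `(rᵢ, rⱼ) = 1` and `k − 1` applications of Lemma 6.1):
  `∑_{r good, r_m = 1} ∏ᵢ φ(rᵢ)²/(g(rᵢ) rᵢ²) (F^{(m)}_r)² = (φ(W)/W)^{k−1} (log R)^{k−1} (J_k^{(m)}(F) + o(1))`;
* `Literature.NumberTheory.Sieve.maynard_S2_asymptotic_of` — PROVED: the three facts give `maynard_S2_asymptotic`
  (substitution of the `y^{(m)}` evaluation into the diagonal sum, with the bound
  `∑_{r good, r_m=1} 1/∏ g(rᵢ) ≤ (∑_{u ≤ R, (u,W)=1} μ²(u)/g(u))^{k−1} ≪ (φ(W) log R/W)^{k−1}` for the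
  cross terms, taken from `CoprimeSquarefreeSums`; `y^{(m)}_max ≪ φ(W) F_max (log R)/W`;
  `N/(φ(W) log N) · (log R)² (φ(W)/W)² · (φ(W)/W)^{k−1} (log R)^{k−1} = 𝔐 · log R/log N`; `D₀ → ∞`).

So, after this file, the `S₂` half of Prop. 4.1 rests on Lemma 5.2 and the two evaluations
separately (and the `S₁` half on Lemma 5.1 and (6.4)–(6.7), `MaynardSieveS1.lean`).

A remark on the weight in `maynard_lemma63_sum`. Substituting the `y^{(m)}` evaluation (no
arithmetic factor besides `∏ φ(rᵢ)/rᵢ`, as printed, Lemma 5.3 having replaced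
`∏ g(rᵢ)rᵢ/φ(rᵢ)²` by `1 + O(D₀⁻¹)`) into `∑_r (y^{(m)}_r)²/∏ g(rᵢ)` produces the weight
`∏ φ(rᵢ)²/(g(rᵢ) rᵢ²)`; the printed display shows `∏ μ(rᵢ)² φ(rᵢ)/(g(rᵢ) rᵢ)` at this point. Both
weights are `1/p + O(1/p²)` at the primes `p > D₀` that occur, so Lemma 6.1 evaluates either sum
as `(φ(W)/W)^{k−1} (log R)^{k−1} J^{(m)} (1 + o(1))` (with `γ(p) = 1 + 1/(p² − p − 1)` as printed,
resp. `γ(p) = p(p−1)²/(p³ − p² − 2p + 1)`); we vendor the statement for the weight that the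
substitution produces, which is what the assembly consumes.

## References

* J. Maynard, *Small gaps between primes*, Ann. of Math. (2) 181 (2015), 383–413,
  doi:10.4007/annals.2015.181.1.7, arXiv:1311.4600 [MaynardAnnals2015]: Lemma 5.2 (p. 10) and its
  proof (pp. 10–11), Lemma 5.3 (p. 11), Lemma 6.1 (p. 13), Lemma 6.3 and its proof (pp. 13–14).
* D. A. Goldston, S. W. Graham, J. Pintz, C. Y. Yıldırım, *Small gaps between products of two
  primes*, Proc. Lond. Math. Soc. (3) 98 (2009), 741–774 = arXiv:math/0609615, Lemma 4 (p. 6)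
  (Maynard's Lemma 6.1).
-/

noncomputable section

open Finset Filter Asymptotics MeasureTheory
open scoped BigOperators ArithmeticFunction.Moebius

namespace Literature.NumberTheory.Sieve

/-! ### `F^{(m)}_r` and the three named facts -/

/-- `F^{(m)}_{r₁,…,r_k} = ∫₀¹ F(log r₁/log R, …, log r_{m−1}/log R, t_m, log r_{m+1}/log R, …, log r_k/log R) dt_m`
(Maynard 2015, proof of Lemma 6.3, the display defining `F^{(m)}_{r₁,…,r_k}`, p. 14), for the test
function `F` (in the application `F = G · 1_{R_k}`). [cite: MaynardAnnals2015, proof of Lemma 6.3 (definition of F^(m)_r, p. 14)] -/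
def maynardFm (k : ℕ) (F : (Fin k → ℝ) → ℝ) (R : ℝ) (m : Fin k) (r : Fin k → ℕ) : ℝ :=
  ∫ u in (0 : ℝ)..1, F (Function.update (fun i => Real.log (r i) / Real.log R) m u)

/-- **Maynard 2015, Lemma 5.2** (p. 10), for `λ_d = maynardWeight k F R W d` with `F = G · 1_{R_k}`,
`G` continuous (so that `y_max ≤ sup_{[0,1]^k} |G| < ∞`), distinct shifts `hᵢ`, the primes having
level of distribution `θ` in Maynard's sense (§1, p. 3; `MaynardPrimesHaveLevel θ`), `R = N^{θ/2−δ}`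
(`0 < δ`, `0 < θ/2 − δ`, so that the moduli `q < R² W` lie below the level), `W = ∏_{p ≤ D₀} p`, and
residues `v₀ = v₀(N)` with `(v₀ + hᵢ, W) = 1`: for any fixed `A > 0`,
`S₂^{(m)} = N/(φ(W) log N) · ∑_r (y^{(m)}_r)²/∏ᵢ g(rᵢ) + O((y^{(m)}_max)² φ(W)^{k−2} N (log N)^{k−2}/(W^{k−1} D₀)) + O(y_max² N/(log N)^A)`,
`y^{(m)}_r` being the variables of Lemma 5.2 (`maynardYm`), `g` Maynard's totally multiplicative
function with `g(p) = p − 2` (`maynardG`), `y^{(m)}_max = sup_r |y^{(m)}_r|`. Vendored with: the sum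
over the box `1 ≤ rᵢ ≤ ⌊R⌋` (off which `y^{(m)}_r = 0`); `y^{(m)}_max` replaced by any eventual
majorant `Y(N) ≥ |y^{(m)}_r|` (equivalent, the error being monotone in it); the first error term
written as `Y² (φ(W)/W)^{k−1} (log N)^{k−1} N/(φ(W) (log N) D₀)`, which is the printed
`Y² φ(W)^{k−2} N (log N)^{k−2}/(W^{k−1} D₀)` kept meaningful at `k = 1`; and the implied constant
depending on the fixed data `k, h, θ, δ, G, A` (which absorbs `y_max² ≤ sup |G|²`). A deep input
(CRT count of primes in residue classes, the level-of-distribution hypothesis with Cauchy–Schwarz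
for the moduli `q < R²W`, the diagonalisation in the variables `y^{(m)}`, and the prime number
theorem for `X_N = π(2N) − π(N)`), vendored as a named fact. [cite: MaynardAnnals2015, Lemma 5.2] -/
def maynard_lemma52 : Prop :=
  ∀ (k : ℕ) (h : Fin k → ℤ), Function.Injective h →
  ∀ (θ δ : ℝ), 0 < δ → 0 < θ / 2 - δ → MaynardPrimesHaveLevel θ →
  ∀ (G : (Fin k → ℝ) → ℝ), Continuous G →
  ∀ (v₀ : ℕ → ℕ), (∀ N i, Int.gcd ((v₀ N : ℤ) + h i) (maynardW N) = 1) →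
  ∀ (m : Fin k) (Y : ℕ → ℝ),
    (∀ᶠ N : ℕ in atTop, ∀ r ∈ maynardBox k (maynardR θ δ N),
      |maynardYm k ((maynardSimplex k).indicator G) (maynardR θ δ N) (maynardW N) m r| ≤ Y N) →
  ∀ (A : ℝ), 0 < A →
    (fun N : ℕ => maynardS2 k h ((maynardSimplex k).indicator G) (maynardR θ δ N) (maynardW N) (v₀ N) N m
        - (N : ℝ) / ((Nat.totient (maynardW N) : ℝ) * Real.log N) *
            ∑ r ∈ maynardBox k (maynardR θ δ N),
              maynardYm k ((maynardSimplex k).indicator G) (maynardR θ δ N) (maynardW N) m r ^ 2 /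
                ∏ i, maynardG (r i))
      =O[atTop] fun N : ℕ =>
        Y N ^ 2 * ((Nat.totient (maynardW N) : ℝ) / (maynardW N)) ^ (k - 1) * Real.log N ^ (k - 1) *
            (N : ℝ) / ((Nat.totient (maynardW N) : ℝ) * Real.log N * (maynardD0 N : ℝ))
          + (N : ℝ) / Real.log N ^ A

/-- **Maynard 2015, proof of Lemma 6.3, the evaluation of `y^{(m)}`** (p. 14: "Thus we have shown
that if `r_m = 1` and `r = ∏ rᵢ` satisfies `(r, W) = 1` and `μ(r)² = 1` then `y^{(m)}` is given by
`y^{(m)}_{r} = (log R) (φ(W)/W) (∏ᵢ φ(rᵢ)/rᵢ) F^{(m)}_{r} + O(F_max φ(W) log R/(W D₀))`, and otherwise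
`y^{(m)}_r = 0`"), for the choice `y_r = F(log rᵢ/log R)` of (6.3) (`F = G · 1_{R_k}`, `G ∈ C¹`),
i.e. for `λ = maynardWeight` (`maynardY_eq`), `R = N^{θ/2−δ}`, `W = ∏_{p ≤ D₀} p`; the estimate is
uniform in `r` (it yields `y^{(m)}_max ≪ φ(W) F_max (log R)/W`, loc. cit.), the implied constant
depending on `k, θ, δ, G`. Obtained in print from Lemma 5.3 (`y^{(m)}_r = ∑_{a_m} y_{r, a_m}/φ(a_m) + O(y_max φ(W) log R/(W D₀))`)
and one application of Lemma 6.1 (`κ = 1`, `γ(p) = 1_{p ∤ W ∏ rᵢ}`, `L ≪ log log N`). A deep input,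
vendored as a named fact (the vanishing part is `maynardYm_eq_zero_of_ne_one` and
`maynardYm_eq_zero_of_not_isGood`). [cite: MaynardAnnals2015, proof of Lemma 6.3 (evaluation of y^(m), p. 14)] -/
def maynard_lemma63_ym : Prop :=
  ∀ (k : ℕ) (θ δ : ℝ), 0 < δ → 0 < θ / 2 - δ →
  ∀ (G : (Fin k → ℝ) → ℝ), ContDiff ℝ 1 G →
  ∀ (m : Fin k), ∃ C : ℝ, ∀ᶠ N : ℕ in atTop, ∀ r : Fin k → ℕ,
    r m = 1 → Squarefree (∏ i, r i) → Nat.Coprime (∏ i, r i) (maynardW N) →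
      |maynardYm k ((maynardSimplex k).indicator G) (maynardR θ δ N) (maynardW N) m r
          - Real.log (maynardR θ δ N) * ((Nat.totient (maynardW N) : ℝ) / (maynardW N)) *
              (∏ i, (Nat.totient (r i) : ℝ) / (r i)) *
              maynardFm k ((maynardSimplex k).indicator G) (maynardR θ δ N) m r|
        ≤ C * ((Nat.totient (maynardW N) : ℝ) / (maynardW N)) * Real.log (maynardR θ δ N) /
            (maynardD0 N : ℝ)

/-- **Maynard 2015, proof of Lemma 6.3, the evaluation of the smooth sum** (p. 14, from "We obtain
`S₂^{(m)} = (φ(W) N (log R)²/(W² log N)) ∑_{(rᵢ,W)=1, (rᵢ,rⱼ)=1, r_m=1} (∏ …)(F^{(m)}_r)² + O(…)`"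
to the end of the proof): removing the conditions `(rᵢ, rⱼ) = 1` at the cost
`O(F_max² φ(W)^k N (log N)^k/(W^{k+1} D₀))` and applying Lemma 6.1 to each of the `k − 1` variables
`rᵢ`, `i ≠ m` (`κ = 1`, `L ≪ log D₀`) evaluates the sum as `(φ(W)/W)^{k−1} (log R)^{k−1} J_k^{(m)}(F)`
up to `o` of its size. Vendored for `F = G · 1_{R_k}`, `G ∈ C¹`, `R = N^{θ/2−δ}`, `W = ∏_{p ≤ D₀} p`,
the sum running over `1 ≤ rᵢ ≤ ⌊R⌋` with `r_m = 1`, `∏ rᵢ` squarefree and coprime to `W`, and with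
the weight `∏ᵢ φ(rᵢ)²/(g(rᵢ) rᵢ²)` that the substitution of the `y^{(m)}` evaluation into Lemma 5.2
produces (the printed display shows `∏ μ(rᵢ)² φ(rᵢ)/(g(rᵢ) rᵢ)`; both are `1/p + O(p⁻²)` at the primes
`p > D₀` that occur and have the same evaluation — see the module docstring), in `o`-form. A deep
input (`(k−1)`-fold partial summation against `∑ μ² w`), vendored as a named fact.
[cite: MaynardAnnals2015, proof of Lemma 6.3 (evaluation of the sum over r, p. 14)] -/
def maynard_lemma63_sum : Prop :=
  ∀ (k : ℕ) (θ δ : ℝ), 0 < δ → 0 < θ / 2 - δ →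
  ∀ (G : (Fin k → ℝ) → ℝ), ContDiff ℝ 1 G →
  ∀ (m : Fin k),
    (fun N : ℕ =>
        ∑ r ∈ (maynardBox k (maynardR θ δ N)).filter
            (fun r => r m = 1 ∧ Squarefree (∏ i, r i) ∧ Nat.Coprime (∏ i, r i) (maynardW N)),
          (∏ i, (Nat.totient (r i) : ℝ) ^ 2 / (maynardG (r i) * (r i : ℝ) ^ 2)) *
            maynardFm k ((maynardSimplex k).indicator G) (maynardR θ δ N) m r ^ 2
        - ((Nat.totient (maynardW N) : ℝ) / (maynardW N)) ^ (k - 1) *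
            Real.log (maynardR θ δ N) ^ (k - 1) * maynardJ k m ((maynardSimplex k).indicator G))
      =o[atTop] fun N : ℕ =>
        ((Nat.totient (maynardW N) : ℝ) / (maynardW N)) ^ (k - 1) * Real.log (maynardR θ δ N) ^ (k - 1)


/-! ### Elementary facts about `R`, `D₀`, `W` -/

/-- `log R = (θ/2 − δ) log N` for `N ≥ 1`. [folklore] -/
theorem log_maynardR {θ δ : ℝ} {N : ℕ} (hN : 1 ≤ N) :
    Real.log (maynardR θ δ N) = (θ / 2 - δ) * Real.log N := by
  unfold maynardR
  have hN0 : (0 : ℝ) < N := by exact_mod_cast hN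
  rw [Real.log_rpow hN0]

/-- `W = ∏_{p ≤ D₀} p ≤ 4^{D₀}` (Chebyshev's bound for the primorial, Mathlib). [folklore] -/
theorem maynardW_le_four_pow (N : ℕ) : (maynardW N : ℝ) ≤ 4 ^ maynardD0 N := by
  unfold maynardW
  exact_mod_cast primorial_le_four_pow (maynardD0 N)

/-- Eventually `D₀ ≥ 2`, so `W` is even and every prime `p ≤ D₀` divides `W`. [folklore] -/
theorem eventually_two_le_maynardD0 : ∀ᶠ N : ℕ in atTop, 2 ≤ maynardD0 N := by
  have h := (tendsto_atTop.mp tendsto_maynardD0_atTop) 2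
  filter_upwards [h] with N hN
  exact_mod_cast hN

/-- Every prime `p ≤ D₀` divides `W = ∏_{p ≤ D₀} p`. [folklore] -/
theorem dvd_maynardW_of_prime_le {N p : ℕ} (hp : p.Prime) (hle : p ≤ maynardD0 N) : p ∣ maynardW N :=
  hp.dvd_primorial_iff.2 hle

/-- For `b ≥ 1`: `b^{D₀} = o(log N)` (`D₀ ≤ log log log N`, so `b^{D₀} ≤ (log log N)^{log b}`). [folklore] -/
theorem isLittleO_pow_maynardD0_log {b : ℝ} (hb : 1 ≤ b) :
    (fun N : ℕ => b ^ maynardD0 N) =o[atTop] fun N : ℕ => Real.log N := by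
  -- `b^{D₀} ≤ (log log N)^{log b}` eventually
  have hlogb : 0 ≤ Real.log b := Real.log_nonneg hb
  have hLL : Tendsto (fun N : ℕ => Real.log (Real.log (N : ℝ))) atTop atTop :=
    Real.tendsto_log_atTop.comp (Real.tendsto_log_atTop.comp tendsto_natCast_atTop_atTop)
  have h1 : ∀ᶠ N : ℕ in atTop, ‖b ^ maynardD0 N‖ ≤ ‖Real.log (Real.log (N : ℝ)) ^ Real.log b‖ := by
    filter_upwards [hLL.eventually_ge_atTop 1] with N hN
    have hLLpos : 0 < Real.log (Real.log (N : ℝ)) := by linarith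
    have hD0 : (maynardD0 N : ℝ) ≤ Real.log (Real.log (Real.log (N : ℝ))) := by
      unfold maynardD0
      exact Nat.floor_le (Real.log_nonneg hN)
    rw [Real.norm_of_nonneg (by positivity), Real.norm_of_nonneg (by positivity)]
    calc b ^ maynardD0 N = Real.exp (Real.log b * maynardD0 N) := by
          rw [← Real.rpow_natCast, Real.rpow_def_of_pos (by linarith)]
      _ ≤ Real.exp (Real.log b * Real.log (Real.log (Real.log (N : ℝ)))) := by
          gcongr
      _ = Real.log (Real.log (N : ℝ)) ^ Real.log b := by
          rw [Real.rpow_def_of_pos hLLpos, mul_comm]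
  have h2 : (fun N : ℕ => Real.log (Real.log (N : ℝ)) ^ Real.log b) =o[atTop]
      fun N : ℕ => Real.log N := by
    have h := (isLittleO_log_rpow_rpow_atTop (Real.log b) one_pos).comp_tendsto
      (Real.tendsto_log_atTop.comp tendsto_natCast_atTop_atTop)
    refine h.congr' EventuallyEq.rfl ?_
    filter_upwards with N
    simp [Function.comp]
  exact (IsBigO.of_bound' h1).trans_isLittleO h2

/-! ### Bounds for `F = G · 1_{R_k}` and `F^{(m)}` -/

/-- A continuous `G` is bounded on the simplex, so `F = G · 1_{R_k}` is bounded on `ℝ^k`. [folklore] -/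
theorem exists_bound_indicator_of_continuous {k : ℕ} {G : (Fin k → ℝ) → ℝ} (hG : Continuous G) :
    ∃ M : ℝ, 0 ≤ M ∧ ∀ t, |(maynardSimplex k).indicator G t| ≤ M := by
  obtain ⟨C, hC⟩ := (isCompact_maynardSimplex k).exists_bound_of_continuousOn hG.continuousOn
  refine ⟨max C 0, le_max_right _ _, fun t => ?_⟩
  by_cases ht : t ∈ maynardSimplex k
  · rw [Set.indicator_of_mem ht]
    exact (hC t ht).trans (le_max_left _ _)
  · rw [Set.indicator_of_notMem ht, abs_zero]
    exact le_max_right _ _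

/-- `|F^{(m)}_r| ≤ sup |F|`. [folklore] -/
theorem abs_maynardFm_le {k : ℕ} {F : (Fin k → ℝ) → ℝ} {M : ℝ} (hM : ∀ t, |F t| ≤ M)
    (R : ℝ) (m : Fin k) (r : Fin k → ℕ) : |maynardFm k F R m r| ≤ M := by
  unfold maynardFm
  have h := intervalIntegral.norm_integral_le_of_norm_le_const (a := (0 : ℝ)) (b := 1) (C := M)
    (f := fun u => F (Function.update (fun i => Real.log (r i) / Real.log R) m u))
    (fun x _ => by rw [Real.norm_eq_abs]; exact hM _)
  simpa using h

/-! ### Support and sign facts for `y^{(m)}` and `g` -/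

/-- `y^{(m)}_r = 0` unless `r` is a good tuple of the box (`1 ≤ rᵢ ≤ ⌊R⌋`, `∏ rᵢ` squarefree and
coprime to `W`): the `λ_d` in its defining sum vanish otherwise (via the bridge `maynardYm_eq_ym` to
`MaynardSieveBilinear`). [cite: MaynardAnnals2015, proof of Lemma 6.3 ("otherwise y^(m) = 0", p. 14)] -/
theorem maynardYm_eq_zero_of_not_mem_boxG {k : ℕ} (F : (Fin k → ℝ) → ℝ) (R : ℝ) (W : ℕ)
    (m : Fin k) {r : Fin k → ℕ} (hr : r ∉ MaynardSieve.boxG k W ⌊R⌋₊) :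
    maynardYm k F R W m r = 0 := by
  rw [maynardYm_eq_ym]
  unfold MaynardSieve.ym MaynardSieve.Yv
  by_contra hne
  exact hr (MaynardSieve.mem_boxG_of_Ssum_ne_zero _ (right_ne_zero_of_mul hne))

/-- `g(rᵢ) > 0` for the entries of a good tuple when `W` is even (all prime factors are `≥ 3`). [folklore] -/
theorem maynardG_pos_of_mem_boxG {k W B : ℕ} (hW : 2 ∣ W) {r : Fin k → ℕ}
    (hr : r ∈ MaynardSieve.boxG k W B) (i : Fin k) : 0 < maynardG (r i) := by
  have hG1 := MaynardSieve.apply_mem_G1_of_mem_boxG hr i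
  rw [maynardG_eq_gAF_of_squarefree (MaynardSieve.mem_G1.1 hG1).2.1]
  exact MaynardSieve.gAF_pos_of_mem_G1 hW hG1

/-- `g(u) > 0` for good scalars `u` when `W` is even. [folklore] -/
theorem maynardG_pos_of_mem_G1 {W B u : ℕ} (hW : 2 ∣ W) (hu : u ∈ MaynardSieve.G1 W B) :
    0 < maynardG u := by
  rw [maynardG_eq_gAF_of_squarefree (MaynardSieve.mem_G1.1 hu).2.1]
  exact MaynardSieve.gAF_pos_of_mem_G1 hW hu

/-- `0 ≤ ∏ φ(rᵢ)/rᵢ ≤ 1`. [folklore] -/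
theorem prod_totient_div_le_one {k : ℕ} (r : Fin k → ℕ) :
    0 ≤ ∏ i, (Nat.totient (r i) : ℝ) / (r i) ∧ ∏ i, (Nat.totient (r i) : ℝ) / (r i) ≤ 1 := by
  refine ⟨Finset.prod_nonneg fun i _ => by positivity, Finset.prod_le_one (fun i _ => by positivity)
    fun i _ => ?_⟩
  rcases Nat.eq_zero_or_pos (r i) with h0 | hpos
  · rw [h0]; simp
  · rw [div_le_one (by exact_mod_cast hpos)]
    exact_mod_cast Nat.totient_le (r i)


/-! ### The one-dimensional bound `∑_{u ≤ x, (u,W)=1} μ²(u)/g(u) ≪ (φ(W)/W) log x` and the product bound -/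

/-- The prime weights `c_p = 2/(p − 2)` (`c₂ = 0`) for which the weight `w_c(n)/n` of
`CoprimeSquarefreeSums` is `μ²(n) 1_{(n,W)=1}/g(n)` when `W` is even. [folklore] -/
def gCoeff (p : ℕ) : ℝ := 2 / ((p : ℝ) - 2)

/-- `|c_p| ≤ 6/p`. [folklore] -/
theorem abs_gCoeff_le (p : ℕ) (hp : p.Prime) : |gCoeff p| ≤ 6 / p := by
  unfold gCoeff
  rcases hp.eq_two_or_odd' with rfl | hodd
  · norm_num
  · have h2 := hp.two_le
    have hne : p ≠ 2 := fun h => by rw [h] at hodd; exact absurd hodd (by decide)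
    have h3 : (3 : ℝ) ≤ p := by exact_mod_cast (show 3 ≤ p by omega)
    rw [abs_of_nonneg (by apply div_nonneg <;> linarith), div_le_div_iff₀ (by linarith) (by linarith)]
    nlinarith

/-- For `W` even and `n ≥ 1` squarefree and coprime to `W`: `w_c(n)/n = 1/g(n)` for `c_p = 2/(p − 2)`
(`∏_{p ∣ n} (1 + 2/(p−2))/p = ∏_{p ∣ n} 1/(p − 2)`, all `p ≥ 3`). [folklore] -/
theorem wfun_gCoeff_div_eq {W n : ℕ} (hW : 2 ∣ W) (hn : n ≠ 0) (hsq : Squarefree n)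
    (hco : n.Coprime W) : SquarefreeSums.wfun W gCoeff n / n = 1 / maynardG n := by
  rw [SquarefreeSums.wfun_apply_of n hn hsq hco, maynardG_of_squarefree hsq]
  have hn' : (n : ℝ) = ∏ p ∈ n.primeFactors, (p : ℝ) := by
    rw [← Nat.cast_prod, Nat.prod_primeFactors_of_squarefree hsq]
  rw [hn']
  have hp3 : ∀ p ∈ n.primeFactors, (3 : ℝ) ≤ p := by
    intro p hp
    have hpp := Nat.prime_of_mem_primeFactors hp
    have hpn := Nat.dvd_of_mem_primeFactors hp
    have hp2 : p ≠ 2 := by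
      rintro rfl
      exact Nat.prime_two.ne_one ((Nat.Coprime.coprime_dvd_left hpn hco).eq_one_of_dvd hW)
    have := hpp.two_le
    exact_mod_cast (show 3 ≤ p by omega)
  have key : ∀ p ∈ n.primeFactors, (1 + gCoeff p) / (p : ℝ) = ((p : ℝ) - 2)⁻¹ := by
    intro p hp
    have h3 := hp3 p hp
    unfold gCoeff
    have h1 : (p : ℝ) - 2 ≠ 0 := by linarith
    have h2 : (p : ℝ) ≠ 0 := by linarith
    field_simp
    ring
  calc (∏ p ∈ n.primeFactors, (1 + gCoeff p)) / ∏ p ∈ n.primeFactors, (p : ℝ)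
      = ∏ p ∈ n.primeFactors, (1 + gCoeff p) / (p : ℝ) := by rw [Finset.prod_div_distrib]
    _ = ∏ p ∈ n.primeFactors, ((p : ℝ) - 2)⁻¹ := Finset.prod_congr rfl key
    _ = 1 / ∏ p ∈ n.primeFactors, ((p : ℝ) - 2) := by rw [Finset.prod_inv_distrib, one_div]

/-- **`∑_{u ≤ x, (u,W)=1} μ²(u)/g(u) ≪ (φ(W)/W) log x`** (Maynard 2015, proof of Lemma 5.2, the bound
used between (5.25) and (5.26), and proof of Lemma 6.3), in the explicit form supplied by
`CoprimeSquarefreeSums` (`c_p = 2/(p−2)`, `C₀ = 6`): for `W ≥ 1` even with every prime `≤ D₀`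
dividing `W` (`D₀ ≥ 1`) and `x ≥ 1`,
`∑_{u ≤ x good} 1/g(u) ≤ (φ(W)/W)(1 + B(6) D₀^{-1/4}) log x + (harmErr W + 4) B(6)`. [cite: MaynardAnnals2015, proof of Lemma 5.2 (the bound ∑_{u<R,(u,W)=1} μ(u)²/g(u) ≪ φ(W) log R/W)] -/
theorem sum_inv_maynardG_le {W : ℕ} (hW0 : W ≠ 0) (hW : 2 ∣ W) {D₀ : ℕ} (hD0 : 1 ≤ D₀)
    (hD : ∀ p, p.Prime → p ≤ D₀ → p ∣ W) {x : ℝ} (hx : 1 ≤ x) :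
    ∑ u ∈ MaynardSieve.G1 W ⌊x⌋₊, 1 / maynardG u ≤
      (W.totient : ℝ) / W * (1 + SquarefreeSums.bConst 6 * (D₀ : ℝ) ^ (-(1 : ℝ) / 4)) * Real.log x
        + (SquarefreeSums.harmErr W + 4) * SquarefreeSums.bConst 6 := by
  have h := SquarefreeSums.abs_sum_wfun_div_sub_log_le (W := W) (c := gCoeff) hW0 (C₀ := 6)
    abs_gCoeff_le hD0 hD hx
  have heq : ∑ u ∈ MaynardSieve.G1 W ⌊x⌋₊, 1 / maynardG u =
      ∑ n ∈ Icc 1 ⌊x⌋₊, SquarefreeSums.wfun W gCoeff n / n := by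
    unfold MaynardSieve.G1
    rw [Finset.sum_filter]
    refine Finset.sum_congr rfl fun n hn => ?_
    split_ifs with hgood
    · rw [wfun_gCoeff_div_eq hW (by have := (Finset.mem_Icc.1 hn).1; omega) hgood.1 hgood.2]
    · rw [SquarefreeSums.wfun_apply, if_neg (fun h' => hgood h'.2), zero_div]
  rw [heq]
  have h' := (abs_le.1 h).2
  linarith

/-- **`∑_{r good, r_m = 1} ∏ᵢ 1/g(rᵢ) ≤ (∑_{u ≤ R good} 1/g(u))^{k−1}`** (the sum over tuples is
dominated by the product of the one-variable sums; `W` even so that all terms are nonnegative).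
[cite: MaynardAnnals2015, proof of Lemma 5.2 (the factor (∑_{u<R,(u,W)=1} μ(u)²/g(u))^{k−1})] -/
theorem sum_prod_inv_maynardG_le {k W : ℕ} (hW : 2 ∣ W) (R : ℝ) (m : Fin k) :
    ∑ r ∈ (maynardBox k R).filter
        (fun r => r m = 1 ∧ Squarefree (∏ i, r i) ∧ Nat.Coprime (∏ i, r i) W),
        ∏ i, 1 / maynardG (r i)
      ≤ (∑ u ∈ MaynardSieve.G1 W ⌊R⌋₊, 1 / maynardG u) ^ (k - 1) := by
  classical
  set L := ∑ u ∈ MaynardSieve.G1 W ⌊R⌋₊, 1 / maynardG u with hL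
  set t : Fin k → Finset ℕ := fun i => if i = m then {1} else MaynardSieve.G1 W ⌊R⌋₊ with ht
  have htm : t m = {1} := by simp [ht]
  have hti : ∀ i, i ≠ m → t i = MaynardSieve.G1 W ⌊R⌋₊ := fun i hi => by simp [ht, hi]
  have hsub : (maynardBox k R).filter
      (fun r => r m = 1 ∧ Squarefree (∏ i, r i) ∧ Nat.Coprime (∏ i, r i) W) ⊆ Fintype.piFinset t := by
    intro r hr
    rw [Finset.mem_filter] at hr
    obtain ⟨hbox, hrm, hsq, hco⟩ := hr
    have hrG : r ∈ MaynardSieve.boxG k W ⌊R⌋₊ := MaynardSieve.mem_boxG.2 ⟨hbox, hsq, hco⟩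
    rw [Fintype.mem_piFinset]
    intro i
    by_cases hi : i = m
    · subst hi; rw [htm, hrm]; exact Finset.mem_singleton_self 1
    · rw [hti i hi]; exact MaynardSieve.apply_mem_G1_of_mem_boxG hrG i
  have hnonneg : ∀ r ∈ Fintype.piFinset t, 0 ≤ ∏ i, 1 / maynardG (r i) := by
    intro r hr
    rw [Fintype.mem_piFinset] at hr
    refine Finset.prod_nonneg fun i _ => ?_
    have hri := hr i
    by_cases hi : i = m
    · subst hi
      rw [htm, Finset.mem_singleton] at hri
      rw [hri, maynardG_one]; norm_num
    · rw [hti i hi] at hri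
      exact (one_div_pos.2 (maynardG_pos_of_mem_G1 hW hri)).le
  calc ∑ r ∈ (maynardBox k R).filter
          (fun r => r m = 1 ∧ Squarefree (∏ i, r i) ∧ Nat.Coprime (∏ i, r i) W),
          ∏ i, 1 / maynardG (r i)
      ≤ ∑ r ∈ Fintype.piFinset t, ∏ i, 1 / maynardG (r i) :=
        Finset.sum_le_sum_of_subset_of_nonneg hsub fun r hr _ => hnonneg r hr
    _ = ∏ i, ∑ j ∈ t i, 1 / maynardG j := (Finset.prod_univ_sum t fun _ j => 1 / maynardG j).symm
    _ = (∑ j ∈ t m, 1 / maynardG j) * ∏ i ∈ Finset.univ.erase m, ∑ j ∈ t i, 1 / maynardG j :=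
        (Finset.mul_prod_erase Finset.univ (fun i => ∑ j ∈ t i, 1 / maynardG j) (Finset.mem_univ m)).symm
    _ = 1 * ∏ _i ∈ Finset.univ.erase m, L := by
        congr 1
        · rw [htm]; simp [maynardG_one]
        · exact Finset.prod_congr rfl fun i hi => by rw [hti i (Finset.ne_of_mem_erase hi)]
    _ = L ^ (k - 1) := by
        rw [one_mul, Finset.prod_const, Finset.card_erase_of_mem (Finset.mem_univ m),
          Finset.card_univ, Fintype.card_fin]


/-! ### Substituting the evaluation of `y^{(m)}` into the diagonal sum -/

/-- `(∏ φ(rᵢ)/rᵢ)² / ∏ g(rᵢ) = ∏ φ(rᵢ)²/(g(rᵢ) rᵢ²)` — the weight produced by the substitution. [folklore] -/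
theorem prod_totient_div_sq_div_prod_maynardG {k : ℕ} (r : Fin k → ℕ) :
    (∏ i, (Nat.totient (r i) : ℝ) / (r i)) ^ 2 / ∏ i, maynardG (r i) =
      ∏ i, (Nat.totient (r i) : ℝ) ^ 2 / (maynardG (r i) * (r i : ℝ) ^ 2) := by
  rw [← Finset.prod_pow, ← Finset.prod_div_distrib]
  refine Finset.prod_congr rfl fun i _ => ?_
  rw [div_pow, div_div, mul_comm]

/-- **The substitution step of the proof of Lemma 6.3** (p. 14, "We now substitute this into our
expression … from Lemma 5.2. We obtain …"), as a finite inequality: if `W` is even, `|F| ≤ M`,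
`P, ε ≥ 0` and `|y^{(m)}_r − P (∏ φ(rᵢ)/rᵢ) F^{(m)}_r| ≤ ε` for all good `r` of the box with `r_m = 1`,
then
`|∑_{r ∈ box} (y^{(m)}_r)²/∏ g(rᵢ) − P² ∑_{r good, r_m=1} ∏ φ(rᵢ)²/(g(rᵢ)rᵢ²) (F^{(m)}_r)²| ≤ (2 P M ε + ε²) ∑_{r good, r_m=1} ∏ 1/g(rᵢ)`
(`y^{(m)}_r = 0` off the good `r` with `r_m = 1`; `y² − m² = (y − m)(y + m)`, `|m_r| ≤ P M`).
[cite: MaynardAnnals2015, proof of Lemma 6.3 (substitution into Lemma 5.2, p. 14)] -/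
theorem abs_sum_maynardYm_sq_div_sub_le {k W : ℕ} (hW : 2 ∣ W) (F : (Fin k → ℝ) → ℝ) (R : ℝ)
    (m : Fin k) {M P ε : ℝ} (hM : ∀ t, |F t| ≤ M) (hP : 0 ≤ P) (hε : 0 ≤ ε)
    (happrox : ∀ r ∈ (maynardBox k R).filter
        (fun r => r m = 1 ∧ Squarefree (∏ i, r i) ∧ Nat.Coprime (∏ i, r i) W),
      |maynardYm k F R W m r - P * (∏ i, (Nat.totient (r i) : ℝ) / (r i)) * maynardFm k F R m r| ≤ ε) :
    |∑ r ∈ maynardBox k R, maynardYm k F R W m r ^ 2 / ∏ i, maynardG (r i)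
        - P ^ 2 * ∑ r ∈ (maynardBox k R).filter
            (fun r => r m = 1 ∧ Squarefree (∏ i, r i) ∧ Nat.Coprime (∏ i, r i) W),
            (∏ i, (Nat.totient (r i) : ℝ) ^ 2 / (maynardG (r i) * (r i : ℝ) ^ 2)) *
              maynardFm k F R m r ^ 2|
      ≤ (2 * P * M * ε + ε ^ 2) *
          ∑ r ∈ (maynardBox k R).filter
            (fun r => r m = 1 ∧ Squarefree (∏ i, r i) ∧ Nat.Coprime (∏ i, r i) W),
            ∏ i, 1 / maynardG (r i) := by
  classical
  set S := (maynardBox k R).filter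
    (fun r => r m = 1 ∧ Squarefree (∏ i, r i) ∧ Nat.Coprime (∏ i, r i) W) with hS
  set y := maynardYm k F R W m with hy
  set mr : (Fin k → ℕ) → ℝ := fun r => P * (∏ i, (Nat.totient (r i) : ℝ) / (r i)) * maynardFm k F R m r
    with hmr
  -- restrict the first sum to `S`
  have hrestrict : ∑ r ∈ maynardBox k R, y r ^ 2 / ∏ i, maynardG (r i) =
      ∑ r ∈ S, y r ^ 2 / ∏ i, maynardG (r i) := by
    rw [hS, Finset.sum_filter_of_ne]
    intro r hr hne
    have hy0 : y r ≠ 0 := fun h0 => hne (by rw [h0]; simp)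
    have hrm : r m = 1 := by
      by_contra hne1
      exact hy0 (maynardYm_eq_zero_of_ne_one F R W m hne1)
    have hrG : r ∈ MaynardSieve.boxG k W ⌊R⌋₊ := by
      by_contra hnot
      exact hy0 (maynardYm_eq_zero_of_not_mem_boxG F R W m hnot)
    exact ⟨hrm, (MaynardSieve.mem_boxG.1 hrG).2.1, (MaynardSieve.mem_boxG.1 hrG).2.2⟩
  rw [hrestrict, Finset.mul_sum, ← Finset.sum_sub_distrib, Finset.mul_sum]
  refine (Finset.abs_sum_le_sum_abs _ _).trans (Finset.sum_le_sum fun r hr => ?_)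
  -- termwise
  have hrS := hr
  rw [hS, Finset.mem_filter] at hr
  obtain ⟨hbox, hrm, hsq, hco⟩ := hr
  have hrG : r ∈ MaynardSieve.boxG k W ⌊R⌋₊ := MaynardSieve.mem_boxG.2 ⟨hbox, hsq, hco⟩
  have hgpos : 0 < ∏ i, maynardG (r i) := Finset.prod_pos fun i _ => maynardG_pos_of_mem_boxG hW hrG i
  have hmain : P ^ 2 * ((∏ i, (Nat.totient (r i) : ℝ) ^ 2 / (maynardG (r i) * (r i : ℝ) ^ 2)) *
      maynardFm k F R m r ^ 2) = mr r ^ 2 / ∏ i, maynardG (r i) := by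
    rw [hmr]
    dsimp only
    rw [← prod_totient_div_sq_div_prod_maynardG]
    field_simp
  rw [hmain, ← sub_div, abs_div, abs_of_pos hgpos, div_le_iff₀ hgpos]
  have hinv : (∏ i, 1 / maynardG (r i)) * ∏ i, maynardG (r i) = 1 := by
    rw [← Finset.prod_mul_distrib]
    exact Finset.prod_eq_one fun i _ => by
      rw [one_div, inv_mul_cancel₀ (maynardG_pos_of_mem_boxG hW hrG i).ne']
  rw [mul_assoc, hinv, mul_one]
  -- |y² − m²| ≤ 2 P M ε + ε²
  have hdiff : |y r - mr r| ≤ ε := happrox r hrS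
  have hmr_le : |mr r| ≤ P * M := by
    rw [hmr]
    dsimp only
    rw [abs_mul, abs_mul, abs_of_nonneg hP]
    have h1 := prod_totient_div_le_one r
    rw [abs_of_nonneg h1.1]
    calc P * (∏ i, (Nat.totient (r i) : ℝ) / (r i)) * |maynardFm k F R m r|
        ≤ P * 1 * M := by
          gcongr
          · exact h1.2
          · exact abs_maynardFm_le hM R m r
      _ = P * M := by ring
  have hfactor : y r ^ 2 - mr r ^ 2 = (y r - mr r) * ((y r - mr r) + 2 * mr r) := by ring
  rw [hfactor, abs_mul]
  calc |y r - mr r| * |y r - mr r + 2 * mr r|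
      ≤ ε * (ε + 2 * (P * M)) := by
        refine mul_le_mul hdiff ?_ (abs_nonneg _) hε
        calc |y r - mr r + 2 * mr r| ≤ |y r - mr r| + |2 * mr r| := abs_add_le _ _
          _ ≤ ε + 2 * (P * M) := by
            rw [abs_mul, abs_two]
            gcongr
    _ = 2 * P * M * ε + ε ^ 2 := by ring


/-! ### Eventual bounds and the sizes of the error terms -/

/-- `harmErr W + 4 ≤ 11 W²` for `W ≥ 1` (`τ(W) ≤ W`, `log W ≤ W`). [folklore] -/
theorem harmErr_add_four_le {W : ℕ} (hW : 1 ≤ W) :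
    SquarefreeSums.harmErr W + 4 ≤ 11 * (W : ℝ) ^ 2 := by
  unfold SquarefreeSums.harmErr
  have hτ : (W.divisors.card : ℝ) ≤ W := by exact_mod_cast Nat.card_divisors_le_self W
  have hτ0 : (0 : ℝ) ≤ W.divisors.card := Nat.cast_nonneg _
  have hlog : Real.log W ≤ W := Real.log_le_self (Nat.cast_nonneg _)
  have hW1 : (1 : ℝ) ≤ W := by exact_mod_cast hW
  have hlog0 : 0 ≤ Real.log W := Real.log_nonneg hW1
  nlinarith [mul_le_mul hτ hlog hlog0 (by linarith), mul_nonneg hτ0 hlog0]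

/-- Eventually (in `N`) `∑_{u ≤ R, u squarefree, (u,W)=1} 1/g(u) ≤ (2 + B(6)) (φ(W)/W) log R`
(`R = N^{θ/2−δ}`, `W = ∏_{p ≤ D₀} p`): the bound `∑_{u<R,(u,W)=1} μ(u)²/g(u) ≪ φ(W) log R/W` of the
proofs of Lemmas 5.2 and 6.3, with the `O_W(1)` of `sum_inv_maynardG_le` absorbed since
`W³ ≤ 64^{D₀} = o(log N)`. [cite: MaynardAnnals2015, proof of Lemma 5.2 (the bound ∑_{u<R,(u,W)=1} μ(u)²/g(u) ≪ φ(W) log R/W)] -/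
theorem eventually_sum_inv_maynardG_le {θ δ : ℝ} (hη : 0 < θ / 2 - δ) :
    ∀ᶠ N : ℕ in atTop, ∑ u ∈ MaynardSieve.G1 (maynardW N) ⌊maynardR θ δ N⌋₊, 1 / maynardG u ≤
      (2 + SquarefreeSums.bConst 6) *
        (((Nat.totient (maynardW N) : ℝ) / (maynardW N)) * Real.log (maynardR θ δ N)) := by
  set b := SquarefreeSums.bConst 6 with hb
  have hb1 : 1 ≤ b := SquarefreeSums.one_le_bConst (by norm_num)
  have hc : 0 < (θ / 2 - δ) / (11 * b) := by positivity
  have h64 := (isLittleO_pow_maynardD0_log (b := (64 : ℝ)) (by norm_num)).bound hc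
  filter_upwards [h64, eventually_two_le_maynardD0, eventually_ge_atTop 2] with N h64N hD2 hN2
  have hN1 : 1 ≤ N := by omega
  have hW0 : maynardW N ≠ 0 := (primorial_pos _).ne'
  have hWpos : (0 : ℝ) < maynardW N := by exact_mod_cast primorial_pos _
  have hW1 : (1 : ℝ) ≤ maynardW N := by exact_mod_cast (primorial_pos (maynardD0 N))
  have hφpos : (0 : ℝ) < Nat.totient (maynardW N) := by
    exact_mod_cast Nat.totient_pos.2 (primorial_pos _)
  have hφ1 : (1 : ℝ) ≤ Nat.totient (maynardW N) := by
    exact_mod_cast Nat.totient_pos.2 (primorial_pos _)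
  have h2W : 2 ∣ maynardW N := dvd_maynardW_of_prime_le Nat.prime_two hD2
  have hD1 : 1 ≤ maynardD0 N := by omega
  have hDW : ∀ p, p.Prime → p ≤ maynardD0 N → p ∣ maynardW N :=
    fun p hp hle => dvd_maynardW_of_prime_le hp hle
  have hR1 : 1 ≤ maynardR θ δ N := by
    unfold maynardR
    exact Real.one_le_rpow (by exact_mod_cast hN1) hη.le
  have hlogR : Real.log (maynardR θ δ N) = (θ / 2 - δ) * Real.log N := log_maynardR hN1
  have hlogN : 0 < Real.log N := Real.log_pos (by exact_mod_cast hN2)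
  have hlogR0 : 0 ≤ Real.log (maynardR θ δ N) := by rw [hlogR]; positivity
  have hL := sum_inv_maynardG_le hW0 h2W hD1 hDW hR1
  -- (i) D₀^{-1/4} ≤ 1
  have hD14 : (maynardD0 N : ℝ) ^ (-(1 : ℝ) / 4) ≤ 1 :=
    Real.rpow_le_one_of_one_le_of_nonpos (by exact_mod_cast hD1) (by norm_num)
  -- (ii) the constant term is ≤ (φ(W)/W) log R
  have hK : (SquarefreeSums.harmErr (maynardW N) + 4) * b ≤
      (Nat.totient (maynardW N) : ℝ) / (maynardW N) * Real.log (maynardR θ δ N) := by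
    have hK1 : (SquarefreeSums.harmErr (maynardW N) + 4) * b ≤ 11 * (maynardW N : ℝ) ^ 2 * b := by
      have := harmErr_add_four_le (W := maynardW N) (primorial_pos _)
      gcongr
    have hW4 : (maynardW N : ℝ) ≤ 4 ^ maynardD0 N := maynardW_le_four_pow N
    have h64' : (64 : ℝ) ^ maynardD0 N ≤ (θ / 2 - δ) / (11 * b) * Real.log N := by
      have := h64N
      rwa [Real.norm_of_nonneg (by positivity), Real.norm_of_nonneg hlogN.le] at this
    -- 11 W² b ≤ 11 b 16^{D₀} and (φ/W) log R ≥ log R / 4^{D₀}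
    have hW2 : (maynardW N : ℝ) ^ 2 * (4 : ℝ) ^ maynardD0 N ≤ (64 : ℝ) ^ maynardD0 N := by
      calc (maynardW N : ℝ) ^ 2 * (4 : ℝ) ^ maynardD0 N
          ≤ ((4 : ℝ) ^ maynardD0 N) ^ 2 * (4 : ℝ) ^ maynardD0 N := by gcongr
        _ = (64 : ℝ) ^ maynardD0 N := by
          rw [← pow_mul, ← pow_add, show maynardD0 N * 2 + maynardD0 N = 3 * maynardD0 N by ring,
            pow_mul]; norm_num
    have hlow : Real.log (maynardR θ δ N) / (4 : ℝ) ^ maynardD0 N ≤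
        (Nat.totient (maynardW N) : ℝ) / (maynardW N) * Real.log (maynardR θ δ N) := by
      rw [div_le_iff₀ (by positivity)]
      calc Real.log (maynardR θ δ N) = 1 / (maynardW N : ℝ) * Real.log (maynardR θ δ N) * maynardW N := by
            field_simp
        _ ≤ (Nat.totient (maynardW N) : ℝ) / (maynardW N) * Real.log (maynardR θ δ N) *
              (4 : ℝ) ^ maynardD0 N := by gcongr
    refine hK1.trans (le_trans ?_ hlow)
    rw [le_div_iff₀ (by positivity), hlogR]
    calc 11 * (maynardW N : ℝ) ^ 2 * b * (4 : ℝ) ^ maynardD0 N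
        = 11 * b * ((maynardW N : ℝ) ^ 2 * (4 : ℝ) ^ maynardD0 N) := by ring
      _ ≤ 11 * b * (64 : ℝ) ^ maynardD0 N := by gcongr
      _ ≤ 11 * b * ((θ / 2 - δ) / (11 * b) * Real.log N) := by gcongr
      _ = (θ / 2 - δ) * Real.log N := by field_simp
  calc ∑ u ∈ MaynardSieve.G1 (maynardW N) ⌊maynardR θ δ N⌋₊, 1 / maynardG u
      ≤ (Nat.totient (maynardW N) : ℝ) / (maynardW N) * (1 + b * (maynardD0 N : ℝ) ^ (-(1 : ℝ) / 4)) *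
          Real.log (maynardR θ δ N) + (SquarefreeSums.harmErr (maynardW N) + 4) * b := hL
    _ ≤ (Nat.totient (maynardW N) : ℝ) / (maynardW N) * (1 + b * 1) * Real.log (maynardR θ δ N) +
          (Nat.totient (maynardW N) : ℝ) / (maynardW N) * Real.log (maynardR θ δ N) := by
        gcongr
    _ = (2 + b) * ((Nat.totient (maynardW N) : ℝ) / (maynardW N) * Real.log (maynardR θ δ N)) := by
        ring

/-- If `g → ∞` then `f/g = o(f)`. [folklore] -/
theorem isLittleO_div_of_tendsto_atTop {f g : ℕ → ℝ} (hg : Tendsto g atTop atTop) :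
    (fun N => f N / g N) =o[atTop] f := by
  rw [Asymptotics.isLittleO_iff]
  intro c hc
  filter_upwards [(tendsto_atTop.mp hg) (1 / c)] with N hN
  have hgpos : 0 < g N := lt_of_lt_of_le (by positivity) hN
  rw [norm_div, Real.norm_of_nonneg hgpos.le, div_le_iff₀ hgpos]
  calc ‖f N‖ = c * (1 / c) * ‖f N‖ := by field_simp
    _ ≤ c * g N * ‖f N‖ := by gcongr
    _ = c * ‖f N‖ * g N := by ring

/-- `N/log N = o(𝔐)`, `𝔐 = φ(W)^k N (log R)^k/W^{k+1}`: indeed `𝔐 ≥ N (η log N)^k/4^{(k+1)D₀}`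
(`φ(W) ≥ 1`, `W ≤ 4^{D₀}`, `log R = η log N`) and `4^{(k+1)D₀} = o(log N)`. This absorbs the
level-of-distribution error `O(y_max² N/(log N)^A)` of Lemma 5.2 (any `A > 0`; here `A = 1`).
[cite: MaynardAnnals2015, proof of Lemma 6.3 (the error O(y_max² N/(log N)^A) of Lemma 5.2 is negligible)] -/
theorem isLittleO_div_log_maynardMainTerm (k : ℕ) {θ δ : ℝ} (hη : 0 < θ / 2 - δ) :
    (fun N : ℕ => (N : ℝ) / Real.log N) =o[atTop] maynardMainTerm k θ δ := by
  set η := θ / 2 - δ with hηdef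
  rw [Asymptotics.isLittleO_iff]
  intro c hc
  have hB := (isLittleO_pow_maynardD0_log (b := (4 : ℝ) ^ (k + 1)) (one_le_pow₀ (by norm_num))).bound
    (show 0 < c * η ^ k by positivity)
  filter_upwards [hB, eventually_ge_atTop 3] with N hN hN3
  have hN0 : (0 : ℝ) < N := by exact_mod_cast (show 0 < N by omega)
  have h3 : (3 : ℝ) ≤ N := by exact_mod_cast hN3
  have hlog1 : 1 ≤ Real.log N := by
    rw [Real.le_log_iff_exp_le hN0]
    have := Real.exp_one_lt_d9
    linarith
  have hlogpos : 0 < Real.log N := by linarith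
  set B := ((4 : ℝ) ^ (k + 1)) ^ maynardD0 N with hBdef
  have hBpos : 0 < B := by positivity
  have hB' : B ≤ c * η ^ k * Real.log N := by
    have := hN
    rwa [Real.norm_of_nonneg hBpos.le, Real.norm_of_nonneg hlogpos.le] at this
  have hWpos : (0 : ℝ) < maynardW N := by exact_mod_cast primorial_pos _
  have hW : (maynardW N : ℝ) ^ (k + 1) ≤ B := by
    rw [hBdef, ← pow_mul, mul_comm, pow_mul]
    exact pow_le_pow_left₀ hWpos.le (maynardW_le_four_pow N) _
  have hφ : (1 : ℝ) ≤ (Nat.totient (maynardW N) : ℝ) ^ k :=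
    one_le_pow₀ (by exact_mod_cast Nat.totient_pos.2 (primorial_pos _))
  have hMT : (N : ℝ) * (η * Real.log N) ^ k / B ≤ maynardMainTerm k θ δ N := by
    unfold maynardMainTerm
    rw [log_maynardR (by omega), ← hηdef]
    have hWk : (0 : ℝ) < (maynardW N : ℝ) ^ (k + 1) := by positivity
    rw [div_le_div_iff₀ hBpos hWk]
    calc (N : ℝ) * (η * Real.log N) ^ k * (maynardW N : ℝ) ^ (k + 1)
        ≤ (N : ℝ) * (η * Real.log N) ^ k * B := by gcongr
      _ = 1 * (N : ℝ) * (η * Real.log N) ^ k * B := by ring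
      _ ≤ (Nat.totient (maynardW N) : ℝ) ^ k * (N : ℝ) * (η * Real.log N) ^ k * B := by gcongr
  have hMTpos : 0 < maynardMainTerm k θ δ N := lt_of_lt_of_le (by positivity) hMT
  rw [Real.norm_of_nonneg (by positivity), Real.norm_of_nonneg hMTpos.le]
  have key : (N : ℝ) / Real.log N ≤ c * ((N : ℝ) * (η * Real.log N) ^ k / B) := by
    have h1 : B ≤ c * η ^ k * Real.log N ^ (k + 1) :=
      hB'.trans (by gcongr; exact le_self_pow₀ hlog1 (by omega))
    rw [div_le_iff₀ hlogpos]
    have h2 : c * ((N : ℝ) * (η * Real.log N) ^ k / B) * Real.log N =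
        (N : ℝ) * (c * η ^ k * Real.log N ^ (k + 1)) / B := by
      rw [mul_pow]
      field_simp
      ring
    rw [h2, le_div_iff₀ hBpos]
    gcongr
  calc (N : ℝ) / Real.log N ≤ c * ((N : ℝ) * (η * Real.log N) ^ k / B) := key
    _ ≤ c * maynardMainTerm k θ δ N := mul_le_mul_of_nonneg_left hMT hc.le

/-- The prefactor identity behind Lemma 6.3:
`N/(φ(W) log N) · ((log R) φ(W)/W)² · (φ(W)/W)^{k−1} (log R)^{k−1} = (log R/log N) · 𝔐`,
`𝔐 = φ(W)^k N (log R)^k/W^{k+1}`, `log R/log N = θ/2 − δ` (written with `k = k' + 1`). [folklore] -/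
theorem maynard_prefactor_identity (k' : ℕ) (θ δ : ℝ) {N : ℕ} (hN : 2 ≤ N) :
    (N : ℝ) / ((Nat.totient (maynardW N) : ℝ) * Real.log N) *
        (Real.log (maynardR θ δ N) * ((Nat.totient (maynardW N) : ℝ) / (maynardW N))) ^ 2 *
        (((Nat.totient (maynardW N) : ℝ) / (maynardW N)) ^ k' * Real.log (maynardR θ δ N) ^ k')
      = (θ / 2 - δ) * maynardMainTerm (k' + 1) θ δ N := by
  unfold maynardMainTerm
  rw [log_maynardR (by omega)]
  have hφ : (0 : ℝ) < Nat.totient (maynardW N) := by exact_mod_cast Nat.totient_pos.2 (primorial_pos _)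
  have hW : (0 : ℝ) < maynardW N := by exact_mod_cast primorial_pos _
  have hlog : 0 < Real.log N := Real.log_pos (by exact_mod_cast hN)
  rw [div_pow, mul_pow, mul_pow]
  field_simp
  ring


/-! ### Lemma 6.3 assembled -/

set_option maxHeartbeats 400000 in
/-- **Maynard 2015, Lemma 6.3 assembled**: Lemma 5.2 (`maynard_lemma52`), the evaluation of `y^{(m)}`
(`maynard_lemma63_ym`) and the evaluation of the smooth sum (`maynard_lemma63_sum`) give the `S₂`
half of Prop. 4.1, `maynard_S2_asymptotic`, along the printed proof (p. 14): the evaluation of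
`y^{(m)}` gives `y^{(m)}_max ≪ φ(W) F_max (log R)/W`, whence the first error of Lemma 5.2 is
`≪ 𝔐/D₀ = o(𝔐)` and the second is `o(𝔐)` (`isLittleO_div_log_maynardMainTerm`); substituting the
evaluation into the diagonal sum (`abs_sum_maynardYm_sq_div_sub_le`) costs `≪ 𝔐/D₀`, by
`∑_{r good, r_m=1} 1/∏ g(rᵢ) ≤ (∑_{u ≤ R,(u,W)=1} μ²(u)/g(u))^{k−1} ≪ (φ(W) log R/W)^{k−1}`
(`sum_prod_inv_maynardG_le`, `eventually_sum_inv_maynardG_le`); and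
`N/(φ(W) log N) · ((log R) φ(W)/W)² · (φ(W)/W)^{k−1} (log R)^{k−1} J^{(m)} = 𝔐 (log R/log N) J^{(m)}`
(`maynard_prefactor_identity`). [cite: MaynardAnnals2015, Lemma 6.3 and its proof] -/
theorem maynard_S2_asymptotic_of (h52 : maynard_lemma52) (h610 : maynard_lemma63_ym)
    (h613 : maynard_lemma63_sum) : maynard_S2_asymptotic := by
  intro k h hinj θ δ hδ hη hlevel G hG v₀ hv₀ m
  obtain ⟨k', rfl⟩ : ∃ k', k = k' + 1 := ⟨k - 1, (Nat.succ_pred_eq_of_pos (Fin.pos m)).symm⟩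
  -- fixed data
  set η := θ / 2 - δ with hηdef
  set F := (maynardSimplex (k' + 1)).indicator G with hFdef
  set J := maynardJ (k' + 1) m F with hJdef
  obtain ⟨M, hM0, hM⟩ := exists_bound_indicator_of_continuous (k := k' + 1) hG.continuous
  obtain ⟨C, hC⟩ := h610 (k' + 1) θ δ hδ hη G hG m
  have e613 := h613 (k' + 1) θ δ hδ hη G hG m
  simp only [Nat.add_sub_cancel] at e613
  set b := SquarefreeSums.bConst 6 with hb
  set cL := 2 + b with hcL
  set Cabs := |C| + 1 with hCabs
  have hCabs0 : 0 ≤ Cabs := by positivity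
  have hCle : |C| ≤ Cabs := by simp [hCabs]
  have hcL0 : 0 ≤ cL := by
    have : 1 ≤ b := SquarefreeSums.one_le_bConst (by norm_num)
    simp only [hcL]; linarith
  -- the `N`-dependent quantities (all abbreviations are definitional)
  set φW : ℕ → ℝ := fun N => (Nat.totient (maynardW N) : ℝ) with hφW
  set Wr : ℕ → ℝ := fun N => (maynardW N : ℝ) with hWr
  set lR : ℕ → ℝ := fun N => Real.log (maynardR θ δ N) with hlR
  set D : ℕ → ℝ := fun N => (maynardD0 N : ℝ) with hD
  set P : ℕ → ℝ := fun N => lR N * (φW N / Wr N) with hP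
  set A : ℕ → ℝ := fun N => (N : ℝ) / (φW N * Real.log N) with hA
  set Q : ℕ → ℝ := fun N => (φW N / Wr N) ^ k' * lR N ^ k' with hQ
  set MT := maynardMainTerm (k' + 1) θ δ with hMT
  set Y : ℕ → ℝ := fun N => (M + Cabs) * P N with hY
  set y : ℕ → (Fin (k' + 1) → ℕ) → ℝ := fun N r =>
    maynardYm (k' + 1) F (maynardR θ δ N) (maynardW N) m r with hy
  set Sset : ℕ → Finset (Fin (k' + 1) → ℕ) := fun N =>
    (maynardBox (k' + 1) (maynardR θ δ N)).filter
      (fun r => r m = 1 ∧ Squarefree (∏ i, r i) ∧ Nat.Coprime (∏ i, r i) (maynardW N)) with hSset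
  set Sy : ℕ → ℝ := fun N => ∑ r ∈ maynardBox (k' + 1) (maynardR θ δ N),
    y N r ^ 2 / ∏ i, maynardG (r i) with hSy
  set SF : ℕ → ℝ := fun N => ∑ r ∈ Sset N,
    (∏ i, (Nat.totient (r i) : ℝ) ^ 2 / (maynardG (r i) * (r i : ℝ) ^ 2)) *
      maynardFm (k' + 1) F (maynardR θ δ N) m r ^ 2 with hSF
  -- basic eventual facts
  have hevD : ∀ᶠ N : ℕ in atTop, 2 ≤ maynardD0 N := eventually_two_le_maynardD0
  have hevN : ∀ᶠ N : ℕ in atTop, 2 ≤ N := eventually_ge_atTop 2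
  have hevL := eventually_sum_inv_maynardG_le (θ := θ) (δ := δ) hη
  -- pointwise positivity facts, valid for every `N ≥ 1`
  have hφWpos : ∀ N, 0 < φW N := fun N => by
    simp only [hφW]; exact_mod_cast Nat.totient_pos.2 (primorial_pos _)
  have hWrpos : ∀ N, 0 < Wr N := fun N => by simp only [hWr]; exact_mod_cast primorial_pos _
  have hlR0 : ∀ N : ℕ, 1 ≤ N → 0 ≤ lR N := fun N hN => by
    simp only [hlR]; rw [log_maynardR hN]; exact mul_nonneg hη.le (Real.log_natCast_nonneg N)
  have hP0 : ∀ N : ℕ, 1 ≤ N → 0 ≤ P N := fun N hN => by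
    simp only [hP]; exact mul_nonneg (hlR0 N hN) (div_pos (hφWpos N) (hWrpos N)).le
  ------------------------------------------------------------------
  -- Step 1: the majorant `Y = (M + |C| + 1) P` of `y^{(m)}`
  ------------------------------------------------------------------
  have hYev : ∀ᶠ N : ℕ in atTop, ∀ r ∈ maynardBox (k' + 1) (maynardR θ δ N), |y N r| ≤ Y N := by
    filter_upwards [hC, hevD, hevN] with N hCN hD2 hN2
    have hN1 : 1 ≤ N := by omega
    have hPN := hP0 N hN1
    have hD1 : (1 : ℝ) ≤ D N := by simp only [hD]; exact_mod_cast (show 1 ≤ maynardD0 N by omega)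
    intro r _
    by_cases hgood : r m = 1 ∧ Squarefree (∏ i, r i) ∧ Nat.Coprime (∏ i, r i) (maynardW N)
    · obtain ⟨hrm, hsq, hco⟩ := hgood
      have h1 := hCN r hrm hsq hco
      have hpr := prod_totient_div_le_one r
      have hmainle : |lR N * (φW N / Wr N) * (∏ i, (Nat.totient (r i) : ℝ) / (r i)) *
          maynardFm (k' + 1) F (maynardR θ δ N) m r| ≤ P N * M := by
        rw [abs_mul, abs_mul, show |lR N * (φW N / Wr N)| = P N from abs_of_nonneg hPN,
          abs_of_nonneg hpr.1]
        calc P N * (∏ i, (Nat.totient (r i) : ℝ) / (r i)) *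
              |maynardFm (k' + 1) F (maynardR θ δ N) m r| ≤ P N * 1 * M := by
              gcongr
              · exact hpr.2
              · exact abs_maynardFm_le hM _ m r
          _ = P N * M := by ring
      have herrle : C * (φW N / Wr N) * lR N / D N ≤ Cabs * P N := by
        have hx0 : 0 ≤ (φW N / Wr N) * lR N := by
          have h1 := hlR0 N hN1
          have h2 := (div_pos (hφWpos N) (hWrpos N)).le
          positivity
        have hx : 0 ≤ (φW N / Wr N) * lR N / D N := by positivity
        calc C * (φW N / Wr N) * lR N / D N = C * ((φW N / Wr N) * lR N / D N) := by ring
          _ ≤ |C| * ((φW N / Wr N) * lR N / D N) :=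
              mul_le_mul_of_nonneg_right (le_abs_self C) hx
          _ ≤ |C| * ((φW N / Wr N) * lR N) :=
              mul_le_mul_of_nonneg_left (div_le_self hx0 hD1) (abs_nonneg C)
          _ = |C| * P N := by simp only [hP]; ring
          _ ≤ Cabs * P N := mul_le_mul_of_nonneg_right hCle hPN
      calc |y N r| = |(y N r - lR N * (φW N / Wr N) * (∏ i, (Nat.totient (r i) : ℝ) / (r i)) *
              maynardFm (k' + 1) F (maynardR θ δ N) m r) +
            lR N * (φW N / Wr N) * (∏ i, (Nat.totient (r i) : ℝ) / (r i)) *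
              maynardFm (k' + 1) F (maynardR θ δ N) m r| := by rw [sub_add_cancel]
        _ ≤ |y N r - lR N * (φW N / Wr N) * (∏ i, (Nat.totient (r i) : ℝ) / (r i)) *
              maynardFm (k' + 1) F (maynardR θ δ N) m r| +
            |lR N * (φW N / Wr N) * (∏ i, (Nat.totient (r i) : ℝ) / (r i)) *
              maynardFm (k' + 1) F (maynardR θ δ N) m r| := abs_add_le _ _
        _ ≤ Cabs * P N + P N * M := add_le_add (h1.trans herrle) hmainle
        _ = Y N := by simp only [hY]; ring
    · have hy0 : y N r = 0 := by
        by_cases hrm : r m = 1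
        · apply maynardYm_eq_zero_of_not_mem_boxG
          intro hrG
          exact hgood ⟨hrm, (MaynardSieve.mem_boxG.1 hrG).2.1, (MaynardSieve.mem_boxG.1 hrG).2.2⟩
        · exact maynardYm_eq_zero_of_ne_one F _ _ m hrm
      rw [hy0, abs_zero]
      simp only [hY]
      positivity
  ------------------------------------------------------------------
  -- Step 2: Lemma 5.2 with this majorant and `A = 1`; its error terms are `o(𝔐)`
  ------------------------------------------------------------------
  have e52 := h52 (k' + 1) h hinj θ δ hδ hη hlevel G hG.continuous v₀ hv₀ m Y hYev 1 one_pos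
  simp only [Nat.add_sub_cancel, Real.rpow_one] at e52
  -- the first error term is `c₁ 𝔐/D₀` eventually
  set c₁ := (M + Cabs) ^ 2 * η ^ 2 / η ^ (k' + 1) with hc₁
  have hg₁ : (fun N : ℕ => Y N ^ 2 * (φW N / Wr N) ^ k' * Real.log N ^ k' * (N : ℝ) /
      (φW N * Real.log N * D N)) =o[atTop] MT := by
    have h1 : (fun N : ℕ => c₁ * (MT N / D N)) =o[atTop] MT :=
      (isLittleO_div_of_tendsto_atTop (f := MT) tendsto_maynardD0_atTop).const_mul_left c₁
    refine h1.congr' ?_ EventuallyEq.rfl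
    filter_upwards [hevN, hevD] with N hN2 hD2
    have hlog : 0 < Real.log N := Real.log_pos (by exact_mod_cast hN2)
    have hDpos : 0 < D N := by simp only [hD]; exact_mod_cast (show 0 < maynardD0 N by omega)
    have hφ := hφWpos N
    have hW := hWrpos N
    simp only [hc₁, hY, hP, hMT, hlR, hφW, hWr, hD, maynardMainTerm]
    rw [log_maynardR (by omega), ← hηdef]
    rw [div_pow, mul_pow, mul_pow, mul_pow]
    field_simp
    ring
  have hg₂ : (fun N : ℕ => (N : ℝ) / Real.log N) =o[atTop] MT :=
    isLittleO_div_log_maynardMainTerm (k' + 1) hη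
  have hT1 : (fun N : ℕ => maynardS2 (k' + 1) h F (maynardR θ δ N) (maynardW N) (v₀ N) N m -
      A N * Sy N) =o[atTop] MT := e52.trans_isLittleO (hg₁.add hg₂)
  ------------------------------------------------------------------
  -- Step 3: the substitution step costs `≪ 𝔐/D₀`
  ------------------------------------------------------------------
  set c₂ := η * cL ^ k' * (2 * M * |C| + C ^ 2) with hc₂
  have hT2bound : ∀ᶠ N : ℕ in atTop, |A N * (Sy N - P N ^ 2 * SF N)| ≤ c₂ * (MT N / D N) := by
    filter_upwards [hC, hevD, hevN, hevL] with N hCN hD2 hN2 hLN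
    have hN1 : 1 ≤ N := by omega
    have hPN := hP0 N hN1
    have hlog : 0 < Real.log N := Real.log_pos (by exact_mod_cast hN2)
    have hDpos : 0 < D N := by simp only [hD]; exact_mod_cast (show 0 < maynardD0 N by omega)
    have hD1 : (1 : ℝ) ≤ D N := by simp only [hD]; exact_mod_cast (show 1 ≤ maynardD0 N by omega)
    have h2W : 2 ∣ maynardW N := dvd_maynardW_of_prime_le Nat.prime_two hD2
    have hA0 : 0 ≤ A N := by simp only [hA]; have := hφWpos N; positivity
    set ε := |C| * P N / D N with hε
    have hε0 : 0 ≤ ε := by positivity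
    -- the approximation hypothesis in the form needed
    have happrox : ∀ r ∈ Sset N, |y N r - P N * (∏ i, (Nat.totient (r i) : ℝ) / (r i)) *
        maynardFm (k' + 1) F (maynardR θ δ N) m r| ≤ ε := by
      intro r hr
      simp only [hSset, Finset.mem_filter] at hr
      obtain ⟨-, hrm, hsq, hco⟩ := hr
      have h1 := hCN r hrm hsq hco
      have hPeq : P N = lR N * (φW N / Wr N) := rfl
      rw [hPeq]
      refine h1.trans ?_
      have hx : 0 ≤ (φW N / Wr N) * lR N / D N := by
        have := hlR0 N hN1; have := (div_pos (hφWpos N) (hWrpos N)).le; positivity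
      calc C * (φW N / Wr N) * lR N / D N = C * ((φW N / Wr N) * lR N / D N) := by ring
        _ ≤ |C| * ((φW N / Wr N) * lR N / D N) := mul_le_mul_of_nonneg_right (le_abs_self C) hx
        _ = ε := by simp only [hε, hP]; ring
    have hsub := abs_sum_maynardYm_sq_div_sub_le h2W F (maynardR θ δ N) m hM hPN hε0 happrox
    -- `∑_{S} ∏ 1/g ≤ L^{k'} ≤ (cL P)^{k'}`
    have hT : ∑ r ∈ Sset N, ∏ i, 1 / maynardG (r i) ≤ (cL * P N) ^ k' := by
      have h1 := sum_prod_inv_maynardG_le (k := k' + 1) h2W (maynardR θ δ N) m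
      simp only [Nat.add_sub_cancel] at h1
      refine h1.trans ?_
      have hL0 : 0 ≤ ∑ u ∈ MaynardSieve.G1 (maynardW N) ⌊maynardR θ δ N⌋₊, 1 / maynardG u :=
        Finset.sum_nonneg fun u hu => (one_div_pos.2 (maynardG_pos_of_mem_G1 h2W hu)).le
      have hLle : ∑ u ∈ MaynardSieve.G1 (maynardW N) ⌊maynardR θ δ N⌋₊, 1 / maynardG u ≤ cL * P N := by
        refine hLN.trans (le_of_eq ?_)
        simp only [hcL, hP, hlR, hφW, hWr]; ring
      exact pow_le_pow_left₀ hL0 hLle k'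
    -- combine
    rw [abs_mul, abs_of_nonneg hA0]
    have hstep : |Sy N - P N ^ 2 * SF N| ≤ (2 * P N * M * ε + ε ^ 2) * (cL * P N) ^ k' :=
      hsub.trans (mul_le_mul_of_nonneg_left hT (by positivity))
    have hid : A N * P N ^ 2 * Q N = η * MT N := by
      simp only [hA, hP, hQ, hMT, hlR, hφW, hWr]
      exact maynard_prefactor_identity k' θ δ hN2
    have hPk : P N ^ k' = Q N := by
      simp only [hQ, hP]; rw [mul_pow, mul_comm]
    have hE : 2 * P N * M * ε + ε ^ 2 ≤ (2 * M * |C| + C ^ 2) * P N ^ 2 / D N := by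
      have h1 : ε ^ 2 ≤ C ^ 2 * P N ^ 2 / D N := by
        have hε2 : ε ^ 2 = C ^ 2 * P N ^ 2 / D N ^ 2 := by
          simp only [hε]; rw [div_pow, mul_pow, sq_abs]
        rw [hε2]
        exact div_le_div_of_nonneg_left (by positivity) hDpos (by nlinarith)
      have h2 : 2 * P N * M * ε = 2 * M * |C| * P N ^ 2 / D N := by
        simp only [hε]; ring
      have h3 : (2 * M * |C| + C ^ 2) * P N ^ 2 / D N =
          2 * M * |C| * P N ^ 2 / D N + C ^ 2 * P N ^ 2 / D N := by ring
      rw [h2, h3]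
      linarith
    have hcLP : 0 ≤ (cL * P N) ^ k' := by positivity
    calc A N * |Sy N - P N ^ 2 * SF N|
        ≤ A N * ((2 * P N * M * ε + ε ^ 2) * (cL * P N) ^ k') :=
          mul_le_mul_of_nonneg_left hstep hA0
      _ ≤ A N * ((2 * M * |C| + C ^ 2) * P N ^ 2 / D N * (cL * P N) ^ k') := by
          gcongr
      _ = (2 * M * |C| + C ^ 2) * cL ^ k' * (A N * P N ^ 2 * Q N) / D N := by
          have hQP : (cL * P N) ^ k' = cL ^ k' * Q N := by rw [← hPk]; exact mul_pow cL (P N) k'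
          rw [hQP]; ring
      _ = c₂ * (MT N / D N) := by rw [hid]; simp only [hc₂]; ring
  have hc₂0 : 0 ≤ c₂ := by positivity
  have hT2 : (fun N : ℕ => A N * (Sy N - P N ^ 2 * SF N)) =o[atTop] MT := by
    have h1 : (fun N : ℕ => A N * (Sy N - P N ^ 2 * SF N)) =O[atTop] fun N => MT N / D N := by
      refine IsBigO.of_bound c₂ ?_
      filter_upwards [hT2bound] with N hN
      rw [Real.norm_eq_abs, Real.norm_eq_abs]
      exact hN.trans (mul_le_mul_of_nonneg_left (le_abs_self _) hc₂0)
    exact h1.trans_isLittleO (isLittleO_div_of_tendsto_atTop tendsto_maynardD0_atTop)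
  ------------------------------------------------------------------
  -- Step 4: the smooth sum, scaled by `A P² = η 𝔐 / Q`
  ------------------------------------------------------------------
  have hT3 : (fun N : ℕ => A N * P N ^ 2 * (SF N - Q N * J)) =o[atTop] MT := by
    have h1 : (fun N : ℕ => A N * P N ^ 2 * (SF N - Q N * J)) =o[atTop]
        fun N => A N * P N ^ 2 * Q N :=
      (isBigO_refl (fun N : ℕ => A N * P N ^ 2) atTop).mul_isLittleO e613
    have h2 : (fun N : ℕ => A N * P N ^ 2 * Q N) =ᶠ[atTop] fun N => η * MT N := by
      filter_upwards [hevN] with N hN2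
      simp only [hA, hP, hQ, hMT, hlR, hφW, hWr]
      exact maynard_prefactor_identity k' θ δ hN2
    exact h1.trans_isBigO (h2.trans_isBigO (isBigO_const_mul_self η MT atTop))
  ------------------------------------------------------------------
  -- Step 5: combine
  ------------------------------------------------------------------
  have hsum := (hT1.add hT2).add hT3
  refine hsum.congr' ?_ EventuallyEq.rfl
  filter_upwards [hevN] with N hN2
  have hid : A N * P N ^ 2 * Q N = η * MT N := by
    simp only [hA, hP, hQ, hMT, hlR, hφW, hWr]
    exact maynard_prefactor_identity k' θ δ hN2
  have hρ : Real.log (maynardR θ δ N) / Real.log N = η := log_maynardR_div_log hN2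
  simp only [hMT] at hid ⊢
  rw [hρ]
  have : A N * P N ^ 2 * (SF N - Q N * J) = A N * P N ^ 2 * SF N - η * maynardMainTerm (k' + 1) θ δ N * J := by
    rw [mul_sub, ← mul_assoc (A N * P N ^ 2), hid]
  rw [this]
  simp only [hA, hSy, hy, hJdef]
  ring

end Literature.NumberTheory.Sieve
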